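import Mathlib.Algebra.MvPolynomial.PDeriv
import Mathlib.LinearAlgebra.Matrix.Determinant.Basic
import Mathlib.ModelTheory.Algebra.Ring.Basic
import Literature.ModelTheory.PseudofiniteFields.FiniteFieldTheory
import HarnessLib

/-!
# The étale-open topology on `K^m` and two theorems about definable sets in pseudo-finite fields

Topic `Literature/ModelTheory/PseudofiniteFields`.  Sources:

* W. Johnson, C.-M. Tran, E. Walsberg, J. Ye, *The étale-open topology and the stable fields
  conjecture*, J. Eur. Math. Soc. 26 (2024) 4033–4070 (arXiv:2009.02319)
  [JohnsonTranWalsbergYe2024]: for a field `K` and a `K`-variety `V`, the images `f(X(K))` of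
  étale morphisms `f : X → V` form a basis of a topology on `V(K)`, the ÉTALE-OPEN topology
  (§1, Def. before Thm A); Theorem A (open / closed immersions induce open / closed topological
  embeddings, so on a locally closed subvariety of `𝔸^m` it is the subspace topology);
  **Theorem 7.1**: `K` is large iff no smooth `K`-point of an irreducible `K`-variety of dimension
  `≥ 1` is isolated in `V(K)`.
* E. Walsberg, J. Ye, *Éz fields*, J. Algebra 614 (2023) 611–649 (arXiv:2103.06919)
  [WalsbergYe2023]: `K` is ÉZ if `K` is large and every definable set is a finite union of
  étale-open subsets of Zariski closed sets; **Theorem D**: perfect bounded PAC fields (in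
  particular pseudo-finite fields) and perfect Frobenius fields are éz; **Theorem C (1)**: for
  `K` large and perfect and `X ⊆ 𝔸^m(K)` éz there are pairwise disjoint smooth irreducible
  subvarieties `V_1, …, V_k` of `𝔸^m` and `X_i` étale-open in `V_i(K)` with `X = ⋃ X_i`.
* F. Pop, *Embedding problems over large fields*, Ann. of Math. 144 (1996) 1–34 [Pop1996]:
  PAC fields are large (Prop. 1.1 ff.); J. Ax, Ann. of Math. 88 (1968) [Ax1968]: pseudo-finite
  fields are perfect PAC with `Gal ≅ Ẑ` (so bounded PAC, and large).

## Rendering (elementary, inside affine space with its coordinates)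

* A basic étale-open set of `K^m` is rendered as the IMAGE OF A STANDARD ÉTALE DATUM
  (`EtaleDatum.image`): for `G_1, …, G_r, H ∈ K[X_1..X_m, T_1..T_r]` the set
  `{x ∈ K^m | ∃ t ∈ K^r, G(x,t) = 0, H(x,t)·det(∂G_i/∂T_j)(x,t) ≠ 0}` — the image of the
  `K`-points of `Spec K[X,T]_{H·J}/(G) → 𝔸^m`, which is standard smooth of relative dimension `0`,
  i.e. étale; every étale morphism is Zariski-locally of this form (Stacks 02GT), so these images
  form a basis of the étale-open topology of `𝔸^m(K)`.
* The topology on a subset `V ⊆ K^m` is the SUBSPACE topology (`IsEtaleOpenIn`,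
  `IsEtaleIsolatedIn`) — for `V` the `K`-points of a locally closed subvariety this is its own
  étale-open topology by [JohnsonTranWalsbergYe2024, Thm A].
* A smooth locally closed subvariety enters through a STANDARD SMOOTH DATUM (`SmoothDatum.locus`):
  `{x | g_1(x) = … = g_c(x) = 0, h(x)·Δ(x) ≠ 0}` with `Δ` the `c × c` Jacobian minor on chosen
  columns — the `K`-points of `Spec K[X]_{hΔ}/(g)`, smooth of pure dimension `m − c`; every smooth
  subvariety of `𝔸^m` is a finite union of such pieces (Jacobian criterion, Stacks 01V9/0CBH).
* Pseudo-finite fields are presented as in `FiniteFieldTheory.lean`: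
  `[Field K] [CompatibleRing K] [Infinite K]`, `K ⊨ finiteFieldTheory`.

The two named facts below are the SPECIAL CASES (pseudo-finite `K`, ambient variety `𝔸^m`) that
the refutation of the crux `PairwiseCurvedTilingsLC` (route MatrixMultiplication /
DefinableSTPPDichotomy) consumes; nothing here is specific to that route.

## Not here

Largeness / PAC as definitions, the intrinsic étale-open topology of an abstract variety,
éz fields in general, Theorems B, E, F of [WalsbergYe2023]; no discharge is attempted.
-/

namespace Literature.ModelTheory.PseudofiniteFields

open MvPolynomial FirstOrder FirstOrder.Language FirstOrder.Ring

section Defs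

variable (K : Type*) [CommRing K]

/-- A **standard étale datum** over `K^m` with `r` auxiliary variables: polynomials
`G_1, …, G_r` and a localising polynomial `H` in `K[X_1, …, X_m, T_1, …, T_r]` (set variables
`Sum.inl`, auxiliary variables `Sum.inr`).  Its image (`EtaleDatum.image`) is a basic open set of
the étale-open topology of `𝔸^m(K)`. [cite: JohnsonTranWalsbergYe2024, §1 (étale images) and Thm A] -/
structure EtaleDatum (m r : ℕ) where
  /-- the equations `G_i(x, t) = 0`, `i < r` -/
  G : Fin r → MvPolynomial (Fin m ⊕ Fin r) K
  /-- the localisation `H(x, t) ≠ 0` -/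
  H : MvPolynomial (Fin m ⊕ Fin r) K

variable {K} {m r c : ℕ}

/-- The Jacobian determinant `det (∂G_i/∂T_j)_{i,j<r}` of a standard étale datum with respect to
the auxiliary variables. [cite: JohnsonTranWalsbergYe2024, §1] -/
noncomputable def EtaleDatum.jacobianDet (D : EtaleDatum K m r) : MvPolynomial (Fin m ⊕ Fin r) K :=
  (Matrix.of fun i j : Fin r => pderiv (Sum.inr j) (D.G i)).det

/-- The **étale image** of a standard étale datum:
`{x ∈ K^m | ∃ t ∈ K^r, G(x,t) = 0 ∧ H(x,t) ≠ 0 ∧ det(∂G/∂T)(x,t) ≠ 0}`, the image of the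
`K`-points of the étale `𝔸^m`-scheme `Spec K[X,T]_{H·J}/(G)`.  These sets form a basis of the
étale-open topology on `𝔸^m(K)`. [cite: JohnsonTranWalsbergYe2024, §1 (étale images form a basis)] -/
def EtaleDatum.image (D : EtaleDatum K m r) : Set (Fin m → K) :=
  {x | ∃ t : Fin r → K, (∀ i, eval (Sum.elim x t) (D.G i) = 0) ∧
    eval (Sum.elim x t) D.H ≠ 0 ∧ eval (Sum.elim x t) D.jacobianDet ≠ 0}

variable (K)

/-- `S` is **étale-open in** `V ⊆ K^m` (subspace topology of the étale-open topology of `K^m`):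
`S ⊆ V` and every point of `S` has a basic étale-open neighbourhood whose trace on `V` lies in
`S`. [cite: JohnsonTranWalsbergYe2024, Thm A (subspace topology on subvarieties)] -/
def IsEtaleOpenIn (V S : Set (Fin m → K)) : Prop :=
  S ⊆ V ∧ ∀ p ∈ S, ∃ (r : ℕ) (D : EtaleDatum K m r), p ∈ D.image ∧ D.image ∩ V ⊆ S

/-- `p` is an **étale-isolated point of** `V ⊆ K^m`: `p ∈ V` and some basic étale-open
neighbourhood of `p` meets `V` only in `p`. [cite: JohnsonTranWalsbergYe2024, §7.1] -/
def IsEtaleIsolatedIn (V : Set (Fin m → K)) (p : Fin m → K) : Prop :=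
  p ∈ V ∧ ∃ (r : ℕ) (D : EtaleDatum K m r), p ∈ D.image ∧ D.image ∩ V ⊆ {p}

/-- A **standard smooth datum** in `𝔸^m` of codimension `c`: equations `g_1, …, g_c`, a
localisation `h`, and `c` distinguished coordinate columns for the Jacobian minor.
[cite: WalsbergYe2023, Thm C (smooth subvarieties), with the Jacobian criterion] -/
structure SmoothDatum (m c : ℕ) where
  /-- the equations `g_i(x) = 0`, `i < c` -/
  g : Fin c → MvPolynomial (Fin m) K
  /-- the localisation `h(x) ≠ 0` -/
  h : MvPolynomial (Fin m) K
  /-- the columns of the distinguished `c × c` Jacobian minor -/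
  cols : Fin c ↪ Fin m

variable {K}

/-- The distinguished Jacobian minor `Δ = det (∂g_i/∂X_{cols j})_{i,j<c}`.
[cite: WalsbergYe2023, Thm C (smooth subvarieties), with the Jacobian criterion] -/
noncomputable def SmoothDatum.minor (S : SmoothDatum K m c) : MvPolynomial (Fin m) K :=
  (Matrix.of fun i j : Fin c => pderiv (S.cols j) (S.g i)).det

/-- The **locus** `{x ∈ K^m | g(x) = 0 ∧ h(x) ≠ 0 ∧ Δ(x) ≠ 0}` of a standard smooth datum: the
`K`-points of `Spec K[X]_{hΔ}/(g_1, …, g_c)`, a smooth locally closed subvariety of `𝔸^m` of pure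
dimension `m − c`. [cite: WalsbergYe2023, Thm C (smooth subvarieties), with the Jacobian criterion] -/
def SmoothDatum.locus (S : SmoothDatum K m c) : Set (Fin m → K) :=
  {x | (∀ i, eval x (S.g i) = 0) ∧ eval x S.h ≠ 0 ∧ eval x S.minor ≠ 0}

end Defs

/-- **Johnson–Tran–Walsberg–Ye 2024, Theorem 7.1 (non-isolation at smooth points), for
pseudo-finite fields.**  Printed: for a field `K` the following are equivalent — `K` is not large;
…; some irreducible `K`-variety `V` of dimension `≥ 1` has a smooth `K`-point that is isolated in
the étale-open topology of `V(K)`.  Pseudo-finite fields are PAC [Ax1968], hence large [Pop1996],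
so over a pseudo-finite `K` NO smooth `K`-point of a positive-dimensional variety is étale-isolated.
Rendering (special case): `K` an infinite field with `K ⊨ finiteFieldTheory`; the variety is the
standard smooth locus `V = {g = 0, hΔ ≠ 0} ⊆ 𝔸^m` of codimension `c < m` (smooth of pure dimension
`m − c ≥ 1`; its irreducible component through `p` is open in `V`, so isolation in `V(K)` is
isolation in that component); the topology on `V(K)` is the subspace topology from `𝔸^m(K)`
(Thm A) with the basis of standard étale images.
-- TODO(general form): arbitrary large `K` and arbitrary `K`-varieties.
[cite: JohnsonTranWalsbergYe2024, Thm 7.1 and Thm A] [cite: Pop1996, Prop. 1.1] -/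
def JohnsonTranWalsbergYe2024_thm71_psf : Prop :=
  ∀ (K : Type) [Field K] [CompatibleRing K] [Infinite K], K ⊨ finiteFieldTheory →
    ∀ (m c : ℕ), c < m → ∀ (S : SmoothDatum K m c) (p : Fin m → K),
      ¬ IsEtaleIsolatedIn K S.locus p

/-- **Walsberg–Ye 2023, Theorems D and C (1) (éz decomposition of definable sets), for
pseudo-finite fields and ambient `𝔸^m`.**  Printed: pseudo-finite fields are perfect bounded PAC,
hence model complete by constants, hence ÉZ (Thm D); and for `K` large and perfect, `V` a smooth
irreducible `K`-variety and `X ⊆ V(K)` éz, there are pairwise disjoint smooth irreducible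
subvarieties `V_1, …, V_k` of `V` and sets `X_i`, étale-open in `V_i(K)`, with `X = ⋃_i X_i`
(Thm C (1)).  Rendering (special case `V = 𝔸^m`, `X = φ(K^m; y)` for a ring formula `φ` with
parameters `y`): each smooth irreducible `V_i` of dimension `≥ 1` is covered by finitely many
standard smooth pieces `{g = 0, hΔ ≠ 0}` of codimension `c_i = m − dim V_i < m` (Jacobian
criterion) on which `X_i` restricts to an étale-open subset (subspace topology, Thm A of
[JohnsonTranWalsbergYe2024]); a `V_i` of dimension `0` with `X_i ≠ ∅` is one `K`-point, so that
`X_i` is a single point.  Disjointness, irreducibility and definability of the pieces are dropped.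
-- TODO(general form): arbitrary large perfect `K`, éz subsets of a smooth irreducible `V`.
[cite: WalsbergYe2023, Thm D and Thm C (1)] [cite: JohnsonTranWalsbergYe2024, Thm A] -/
def WalsbergYe2023_thmC_psf : Prop :=
  ∀ (K : Type) [Field K] [CompatibleRing K] [Infinite K], K ⊨ finiteFieldTheory →
    ∀ (m n : ℕ) (φ : Language.ring.Formula (Fin m ⊕ Fin n)) (y : Fin n → K),
      ∃ (k : ℕ) (c : Fin k → ℕ) (S : ∀ i, SmoothDatum K m (c i)) (X : Fin k → Set (Fin m → K)),
        {x : Fin m → K | φ.Realize (Sum.elim x y)} = ⋃ i, X i ∧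
          ∀ i, (X i).Subsingleton ∨ (c i < m ∧ IsEtaleOpenIn K (S i).locus (X i))

/-! ## First consequences of the definitions (no facts used) -/

section Basic

variable {K : Type*} [CommRing K] {m r c : ℕ}

/-- Unfolding of membership in an étale image. [folklore] -/
theorem EtaleDatum.mem_image_iff (D : EtaleDatum K m r) (x : Fin m → K) :
    x ∈ D.image ↔ ∃ t : Fin r → K, (∀ i, eval (Sum.elim x t) (D.G i) = 0) ∧
      eval (Sum.elim x t) D.H ≠ 0 ∧ eval (Sum.elim x t) D.jacobianDet ≠ 0 :=
  Iff.rfl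

/-- Unfolding of membership in a standard smooth locus. [folklore] -/
theorem SmoothDatum.mem_locus_iff (S : SmoothDatum K m c) (x : Fin m → K) :
    x ∈ S.locus ↔ (∀ i, eval x (S.g i) = 0) ∧ eval x S.h ≠ 0 ∧ eval x S.minor ≠ 0 :=
  Iff.rfl

/-- An étale-open subset of `V` none of whose points is étale-isolated in `V` has no isolated
points of its own: if `S` is étale-open in `V`, `p ∈ S`, and a basic neighbourhood of `p` meets
`S` only in `p`, then `p` is étale-isolated in `V` — provided basic neighbourhoods are stable
under intersection, which is supplied as the hypothesis `hD` (the intersection datum).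
[folklore] -/
theorem isEtaleIsolatedIn_of_isEtaleOpenIn {V S : Set (Fin m → K)} (hS : IsEtaleOpenIn K V S)
    {p : Fin m → K} (hp : p ∈ S) {r₁ : ℕ} (D₁ : EtaleDatum K m r₁) (hiso : D₁.image ∩ S ⊆ {p})
    (hD : ∀ (r₂ : ℕ) (D₂ : EtaleDatum K m r₂), p ∈ D₂.image →
      ∃ (r : ℕ) (D : EtaleDatum K m r), p ∈ D.image ∧ D.image ⊆ D₁.image ∩ D₂.image) :
    IsEtaleIsolatedIn K V p := by
  obtain ⟨hSV, hnb⟩ := hS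
  obtain ⟨r₂, D₂, hp₂, hD₂⟩ := hnb p hp
  obtain ⟨r, D, hpD, hDsub⟩ := hD r₂ D₂ hp₂
  refine ⟨hSV hp, r, D, hpD, fun x hx => ?_⟩
  have hx₁ : x ∈ D₁.image := (hDsub hx.1).1
  have hx₂ : x ∈ D₂.image := (hDsub hx.1).2
  exact hiso ⟨hx₁, hD₂ ⟨hx₂, hx.2⟩⟩

end Basic

end Literature.ModelTheory.PseudofiniteFields
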